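import Mathlib
import Literature.AlgebraicGeometry.Resolution.CobordantGame
import Literature.AlgebraicGeometry.Resolution.CobordantChartCoefficients
import Literature.AlgebraicGeometry.Resolution.CobordantChartPlaneSlice
import Literature.AlgebraicGeometry.Resolution.CobordantTupleGame
import Literature.AlgebraicGeometry.Resolution.FormalCoordinateChange
import Summits.ResolutionOfSingularities.ResolutionOfSingularities.Theorems.WeightedInvariantLocalWeightedDropMonicPointBlowup
import Summits.ResolutionOfSingularities.ResolutionOfSingularities.Theorems.WeightedInvariantLocalWeightedDropMonicDoublePointLift
import Summits.ResolutionOfSingularities.ResolutionOfSingularities.Theorems.WeightedInvariantLocalWeightedDropTerminalDoublePointsAux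
import Summits.ResolutionOfSingularities.ResolutionOfSingularities.Theorems.WeightedInvariantLocalWeightedDropInsepPointStep
import Summits.ResolutionOfSingularities.ResolutionOfSingularities.Theorems.WeightedInvariantLocalWeightedDropInsepXChange

/-!
# `WeightedInvariant.LocalWeightedDrop`, line `hasse-ridge-face-selection`: the point step and the INSEP lift with a CHART SELECTOR
# (at every exceptional point the prover, not the refuter, picks the live slot to slice)

Crux item stmt-ResolutionOfSingularities-8899 `LocalWeightedDrop` (route `ResolutionOfSingularities/WeightedInvariant`),
serving the door `WeightedConstruction` stmt-ResolutionOfSingularities-0571.  [OURS · L1 W4.3, chain w43, stub worker 3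
(gen 3): §4 of stub-3's M6 design memo (L/res-L1-w43-stub-3/M6-DESIGN.md) for the key S2iM `stub_charTwoInseparableReductionWon`;
game plumbing only, no manuscript mathematics.]

`won_monic_of_pointBlowup` (p467919) / `won_dp_of_pointStep` / `InsepDoublePoint`'s lift `won_insep_of_pointStep` (p480811) /
`insepWon_of_stateRank` (p485441) ask the caller to win the slice at an exceptional point `c` in EVERY live chart `i₀` (`c_{i₀} ≠ 0`).
But the live slot is only used to slice (`tameSlice`), so ONE live slot per point suffices — and for Hauser–Wagner's flag-adapted measures
the natural one is «the rigid letter if it is live, else the free letter» (then the three successor presentations are exactly the moves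
(T)/(H) in the chart of the rigid letter and (V) at the flag point; the fourth presentation — a (T)-point seen in the chart of the free
letter — never has to be measured).  This file re-runs the four proofs with a SELECTOR `sel c` (any function with `c (sel c) ≠ 0`
whenever `c ≠ 0`; for the state-carrying lift the selector may depend on the state):
`won_monic_of_pointBlowup_sel`, `won_dp_of_pointStep_sel`, `won_insep_of_pointStep_sel`, `insepWon_of_stateRank_sel`.
-/

set_option linter.dupNamespace false -- mandated namespace of this single-conjunct summit

namespace Summit.ResolutionOfSingularities.ResolutionOfSingularities.Theorems

open Literature.AlgebraicGeometry.Resolution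
open Literature.AlgebraicGeometry.Resolution.CobordantGame

open MonicPointBlowup MvPowerSeries in
/-- THE POINT BLOW-UP OF A MONIC FORM WITH A CHART SELECTOR: as `won_monic_of_pointBlowup`, but at the exceptional point `c' ≠ 0`
(inside `γ = 0`) only the slice in the live slot `sel c'` chosen by the caller has to be won. -/
theorem won_monic_of_pointBlowup_sel (p : ℕ) (hp : p.Prime) (k : Type) [Field k] [CharP k p] (m d : ℕ) (hd : 0 < d)
    (A : Fin d → MvPowerSeries (Fin m) k) (hA : ∀ j : Fin d, ((d - (j : ℕ) : ℕ) : ℕ∞) < (A j).order)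
    (sel : (Fin m → k) → Fin m) (hsel : ∀ c : Fin m → k, (∃ i, c i ≠ 0) → c (sel c) ≠ 0)
    (hsucc : ∀ (c : Fin m → k), (∃ i, c i ≠ 0) → ∀ B : Fin d → MvPowerSeries (Fin (m + 1)) k,
      (∀ j, MvPowerSeries.subst (CobordantChart.chart (fun _ : Fin m => 1) c) (A j) =
        MvPowerSeries.X 0 ^ (d - (j : ℕ) + 1) * B j) →
      CobordantGame.IsSingular k (MvPowerSeries.X (Fin.last m) ^ d +
        ∑ j : Fin d, MvPowerSeries.rename (Fin.succAboveEmb (Fin.last m))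
          (TupleGame.slice (sel c) (MvPowerSeries.X 0 * B j)) * MvPowerSeries.X (Fin.last m) ^ (j : ℕ)) →
      CobordantGame.Won k (m + 1) (MvPowerSeries.X (Fin.last m) ^ d +
        ∑ j : Fin d, MvPowerSeries.rename (Fin.succAboveEmb (Fin.last m))
          (TupleGame.slice (sel c) (MvPowerSeries.X 0 * B j)) * MvPowerSeries.X (Fin.last m) ^ (j : ℕ))) :
    CobordantGame.Won k (m + 1) (MvPowerSeries.X (Fin.last m) ^ d +
      ∑ j : Fin d, MvPowerSeries.rename (Fin.succAboveEmb (Fin.last m)) (A j) * MvPowerSeries.X (Fin.last m) ^ (j : ℕ)) := by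
  classical
  set P : MvPowerSeries (Fin (m + 1)) k := X (Fin.last m) ^ d +
    ∑ j : Fin d, rename (Fin.succAboveEmb (Fin.last m)) (A j) * X (Fin.last m) ^ (j : ℕ) with hP
  refine Won.move X (fun _ => 1) (TangentConeCut.isMove_X_one (Nat.succ_pos m)) fun g hg => ?_
  obtain ⟨pt, a, ⟨l, -, hptl⟩, hfac, hndvd, hsing⟩ := hg
  have hself : subst (X : Fin (m + 1) → MvPowerSeries (Fin (m + 1)) k) P = P := by
    rw [subst_self]; rfl
  rw [hself] at hfac
  -- the factorisations `A_j ∘ chart(c') = s^{d-j+1} B_j`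
  set c : Fin m → k := fun i => pt (Fin.castSucc i) with hc
  have hBex : ∀ j : Fin d, ∃ Bj : MvPowerSeries (Fin (m + 1)) k,
      subst (CobordantChart.chart (fun _ : Fin m => 1) c) (A j) = X 0 ^ (d - (j : ℕ) + 1) * Bj := fun j =>
    exists_eq_X_pow_mul_of_le_order c (A j) _ (Order.add_one_le_of_lt (hA j))
  choose B hB using hBex
  -- the transform and the saturated successor `g₀`
  set γ : k := pt (Fin.last m) with hγ
  set g₀ : MvPowerSeries (Fin (m + 1 + 1)) k := (C γ + X (Fin.last (m + 1))) ^ d +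
    X 0 * ∑ j : Fin d, rename (Fin.succAboveEmb (Fin.last (m + 1))) (B j) * (C γ + X (Fin.last (m + 1))) ^ (j : ℕ)
    with hg₀
  have hT : subst (cruxChart k (fun _ : Fin (m + 1) => 1) pt) P = X 0 ^ d * g₀ := by
    rw [hP, transform_monic A pt B hB]
  have hndvd₀ : ¬ X 0 ∣ g₀ := fun h => by
    have h1 := coeff_top_g₀ (m := m) d γ
      (∑ j : Fin d, rename (Fin.succAboveEmb (Fin.last (m + 1))) (B j) * (C γ + X (Fin.last (m + 1))) ^ (j : ℕ))
    rw [X_dvd_iff.mp h _ (by rw [Finsupp.single_apply, if_neg Fin.last_pos.ne'])] at h1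
    exact zero_ne_one h1
  have hfac₀ := hfac
  rw [hT] at hfac
  obtain ⟨-, hgg⟩ := X_pow_mul_eq_X_pow_mul 0 hfac hndvd₀ hndvd
  subst hgg
  -- `γ = 0`: otherwise `g₀(0) = γ^d ≠ 0`
  have hγ0 : γ = 0 := by
    have h00 := hsing.1
    rw [hg₀, constantCoeff_g₀] at h00
    exact pow_eq_zero_iff (n := d) (by omega) |>.mp h00
  -- the exceptional point is off the vertex and `γ = 0`: `c ≠ 0`, and the caller's slot `sel c` is live
  obtain ⟨i₁, rfl⟩ : ∃ i₁ : Fin m, Fin.castSucc i₁ = l := by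
    rcases Fin.eq_castSucc_or_eq_last l with ⟨i₁, rfl⟩ | rfl
    · exact ⟨i₁, rfl⟩
    · exact absurd hγ0 hptl
  have hcne : ∃ i, c i ≠ 0 := ⟨i₁, hptl⟩
  set i₀ : Fin m := sel c with hi₀
  have hci₀ : c i₀ ≠ 0 := hsel c hcne
  -- the tame slice at `i₀`
  rw [cruxChart_one_eq_chart] at hfac₀
  obtain ⟨Φ₂, u, hΦ₂0, hΦ₂det, hu, hgeq⟩ := tameSlice p hp k (m + 1) P (fun _ => 1) pt
    (fun i hi => absurd hi one_ne_zero) a g₀ hfac₀ (Fin.castSucc i₀) hci₀ (by exact hp.not_dvd_one)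
  set S : MvPowerSeries (Fin (m + 1)) k := subst (fun j : Fin (m + 1 + 1) => if j = (Fin.castSucc i₀).succ
    then (0 : MvPowerSeries (Fin (m + 1)) k) else X (Fin.predAbove (Fin.castSucc i₀) j)) g₀ with hS
  suffices hWS : Won k (m + 1) S by
    rw [hgeq]
    exact (won_unit_mul_iff hu _).mpr ((won_subst_iff hΦ₂0 hΦ₂det _).mpr (won_cyl (Fin.castSucc i₀).succ hWS))
  -- the slice is the monic form `y^d + Σ_j (s B_j)| y^j`
  have hSeq : S = X (Fin.last m) ^ d +
      ∑ j : Fin d, rename (Fin.succAboveEmb (Fin.last m)) (TupleGame.slice i₀ (X 0 * B j)) * X (Fin.last m) ^ (j : ℕ) := by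
    rw [hS, hg₀, hγ0]
    exact slice_g₀ i₀ B
  by_cases hSs : IsSingular k S
  · rw [hSeq] at hSs ⊢
    exact hsucc c hcne B hB hSs
  · exact (wonBy_zero_of_not_isSingular m.succ_pos hSs).won

open InsepDoublePoint MvPowerSeries in
/-- THE POINT STEP ON `y² + A₀` WITH A CHART SELECTOR (every characteristic): if `ord A₀ > 2`, the point blow-up wins `y² + A₀` as soon
as, for every direction `c ≠ 0`, the SINGULAR slice `y² + A₀'` in the chart `i₀ = sel c` (`A₀(π_{sel c, c}) = x₀² · A₀'`) is won. -/
theorem won_dp_of_pointStep_sel (p : ℕ) (hp : p.Prime) (k : Type) [Field k] [CharP k p]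
    (A₀ : MvPowerSeries (Fin 2) k) (hA₀ : (2 : ℕ∞) < A₀.order)
    (sel : (Fin 2 → k) → Fin 2) (hsel : ∀ c : Fin 2 → k, (∃ i, c i ≠ 0) → c (sel c) ≠ 0)
    (hsucc : ∀ (c : Fin 2 → k), (∃ i, c i ≠ 0) → ∀ A₀' : MvPowerSeries (Fin 2) k,
      subst (fun l : Fin 2 => if l = sel c then C (c (sel c)) * X 0 else
        X 0 * (C (c l) + (X 1 : MvPowerSeries (Fin 2) k))) A₀ = X 0 ^ 2 * A₀' →
      CobordantGame.IsSingular k (X (Fin.last 2) ^ 2 + rename (Fin.succAboveEmb (Fin.last 2)) A₀') →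
      CobordantGame.Won k 3 (X (Fin.last 2) ^ 2 + rename (Fin.succAboveEmb (Fin.last 2)) A₀')) :
    CobordantGame.Won k 3 (X (Fin.last 2) ^ 2 + rename (Fin.succAboveEmb (Fin.last 2)) A₀) := by
  classical
  have hform : X (Fin.last 2) ^ 2 + rename (Fin.succAboveEmb (Fin.last 2)) A₀ =
      X (Fin.last 2) ^ 2 + ∑ j : Fin 2, rename (Fin.succAboveEmb (Fin.last 2))
        ((![A₀, 0] : Fin 2 → MvPowerSeries (Fin 2) k) j) * X (Fin.last 2) ^ (j : ℕ) := by
    rw [← MonicDoublePointLift.monic_two_eq_sum A₀ 0, map_zero, zero_mul, add_zero]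
  rw [hform]
  refine won_monic_of_pointBlowup_sel p hp k 2 2 two_pos (![A₀, 0]) ?_ sel hsel ?_
  · intro j
    fin_cases j
    · simpa using hA₀
    · simp
  · intro c hc B hB hS
    have hch := CobordantChart.hasSubst_chart (fun _ : Fin 2 => 1) c (fun l hl => absurd hl one_ne_zero)
    -- `B 1 = 0`
    have hB1 : B 1 = 0 := by
      have h := hB 1
      simp only [Matrix.cons_val_one, Matrix.cons_val_zero, Fin.val_one] at h
      rw [← coe_substAlgHom hch, map_zero] at h
      exact (mul_eq_zero.mp h.symm).resolve_left (pow_ne_zero _ (FormalCoordChange.X_ne_zero' _))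
    -- the successor `A₀'`
    have hB0 : subst (CobordantChart.chart (fun _ : Fin 2 => 1) c) A₀ = X 0 ^ 3 * B 0 := by
      have h := hB 0
      simpa using h
    have hfac : subst (fun l : Fin 2 => if l = sel c then C (c (sel c)) * X 0 else
        X 0 * (C (c l) + (X 1 : MvPowerSeries (Fin 2) k))) A₀ = X 0 ^ 2 * TupleGame.slice (sel c) (X 0 * B 0) := by
      rw [← slice_subst_pointChart, hB0, MultiplicityLift.slice_X_zero_pow_mul, ← pow_one (X 0 : MvPowerSeries (Fin 3) k),
        MultiplicityLift.slice_X_zero_pow_mul]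
      ring
    have hSeq : X (Fin.last 2) ^ 2 + ∑ j : Fin 2, rename (Fin.succAboveEmb (Fin.last 2))
        (TupleGame.slice (sel c) (X 0 * B j)) * X (Fin.last 2) ^ (j : ℕ) =
        X (Fin.last 2) ^ 2 + rename (Fin.succAboveEmb (Fin.last 2)) (TupleGame.slice (sel c) (X 0 * B 0)) := by
      rw [Fin.sum_univ_two]
      simp only [Fin.val_zero, Fin.val_one, pow_zero, mul_one, hB1, mul_zero, slice_zero, map_zero, zero_mul, add_zero]
    rw [hSeq] at hS ⊢
    exact hsucc c hc _ hfac hS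

open InsepDoublePoint TerminalDoublePoint MvPowerSeries in
/-- THE INSEP POINT STEP WITH CLEANING AND A CHART SELECTOR (characteristic `2`, `k` algebraically closed): as
`won_insep_of_pointStep`, but at each direction `c ≠ 0` only the chart `i₀ = sel c` is presented to the caller. -/
theorem won_insep_of_pointStep_sel (k : Type) [Field k] [CharP k 2] [IsAlgClosed k]
    (hlow : ∀ g : MvPowerSeries (Fin 1) k, CobordantGame.IsSingular k g → CobordantGame.Won k 1 g)
    (A₀ : MvPowerSeries (Fin 2) k) (hA₀ : (2 : ℕ∞) < A₀.order)
    (sel : (Fin 2 → k) → Fin 2) (hsel : ∀ c : Fin 2 → k, (∃ i, c i ≠ 0) → c (sel c) ≠ 0)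
    (hsucc : ∀ (c : Fin 2 → k), (∃ i, c i ≠ 0) → ∀ (A₀' : MvPowerSeries (Fin 2) k) (α β : k),
      MvPowerSeries.subst (fun l : Fin 2 => if l = sel c then MvPowerSeries.C (c (sel c)) * MvPowerSeries.X 0 else
        MvPowerSeries.X 0 * (MvPowerSeries.C (c l) + (MvPowerSeries.X 1 : MvPowerSeries (Fin 2) k))) A₀ =
        MvPowerSeries.X 0 ^ 2 * A₀' →
      α ^ 2 = MvPowerSeries.coeff (Finsupp.single 0 2) A₀' → β ^ 2 = MvPowerSeries.coeff (Finsupp.single 1 2) A₀' →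
      (2 : ℕ∞) < (A₀' + (MvPowerSeries.C α * MvPowerSeries.X 0 + MvPowerSeries.C β * MvPowerSeries.X 1) ^ 2).order →
      CobordantGame.Won k 3 (MvPowerSeries.X (Fin.last 2) ^ 2 + MvPowerSeries.rename (Fin.succAboveEmb (Fin.last 2))
        (A₀' + (MvPowerSeries.C α * MvPowerSeries.X 0 + MvPowerSeries.C β * MvPowerSeries.X 1) ^ 2))) :
    CobordantGame.Won k 3 (MvPowerSeries.X (Fin.last 2) ^ 2 + MvPowerSeries.rename (Fin.succAboveEmb (Fin.last 2)) A₀) :=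
  won_dp_of_pointStep_sel 2 Nat.prime_two k A₀ hA₀ sel hsel fun c hc A₀' hfac hS =>
    won_dp_of_clean hlow A₀' hS fun α β hα hβ hord => hsucc c hc A₀' α β hfac hα hβ hord

open InsepDoublePoint TerminalDoublePoint MvPowerSeries in
/-- THE INSEP LIFT WITH A STATE AND A CHART SELECTOR (characteristic `2`, `k` algebraically closed; one-variable singular germs won):
as `insepWon_of_stateRank` (p485441), but in the point-blow-up clause the rank has to drop only for the successor presented in the
chart `sel s c` chosen by the prover from the current state `s` and the direction `c ≠ 0` (any selector with `c (sel s c) ≠ 0`).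
For Hauser–Wagner: `s` carries the rigid slot `rig`, and `sel s c = rig` if `c rig ≠ 0`, else the free slot — the successors are then
exactly the moves (T)/(H) (chart of the rigid letter) and (V) (the flag point). -/
theorem insepWon_of_stateRank_sel (k : Type) [Field k] [CharP k 2] [IsAlgClosed k]
    (hlow : ∀ g : MvPowerSeries (Fin 1) k, CobordantGame.IsSingular k g → CobordantGame.Won k 1 g)
    (T : MvPowerSeries (Fin 2) k → Prop)
    (hT : ∀ A₀ : MvPowerSeries (Fin 2) k, T A₀ →
      CobordantGame.Won k 3 (X (Fin.last 2) ^ 2 + rename (Fin.succAboveEmb (Fin.last 2)) A₀))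
    {S : Type} (κ : S → MvPowerSeries (Fin 2) k → Ordinal.{0})
    (sel : S → (Fin 2 → k) → Fin 2) (hsel : ∀ (s : S) (c : Fin 2 → k), (∃ i, c i ≠ 0) → c (sel s c) ≠ 0)
    (hstep : ∀ (s : S) (A₀ : MvPowerSeries (Fin 2) k), (2 : ℕ∞) < A₀.order → T A₀ ∨
      (∃ φ : MvPowerSeries (Fin 2) k, constantCoeff φ = 0 ∧ (2 : ℕ∞) < (A₀ + φ ^ 2).order ∧
        (T (A₀ + φ ^ 2) ∨ ∃ s' : S, κ s' (A₀ + φ ^ 2) < κ s A₀)) ∨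
      (∃ θ : Fin 2 → MvPowerSeries (Fin 2) k, (∀ i, constantCoeff (θ i) = 0) ∧
        IsUnit (Matrix.det (Matrix.of fun i j => coeff (Finsupp.single j 1) (θ i))) ∧
        (T (subst θ A₀) ∨ ∃ s' : S, κ s' (subst θ A₀) < κ s A₀)) ∨
      (∀ (c : Fin 2 → k), (∃ i, c i ≠ 0) → ∀ (A' : MvPowerSeries (Fin 2) k) (α β : k),
        subst (fun l : Fin 2 => if l = sel s c then C (c (sel s c)) * X 0 else
          X 0 * (C (c l) + (X 1 : MvPowerSeries (Fin 2) k))) A₀ = X 0 ^ 2 * A' →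
        α ^ 2 = coeff (Finsupp.single 0 2) A' → β ^ 2 = coeff (Finsupp.single 1 2) A' →
        (2 : ℕ∞) < (A' + (C α * X 0 + C β * X 1) ^ 2).order →
        T (A' + (C α * X 0 + C β * X 1) ^ 2) ∨ ∃ s' : S, κ s' (A' + (C α * X 0 + C β * X 1) ^ 2) < κ s A₀) ∨
      (∃ (i : Fin 2) (A₀' : MvPowerSeries (Fin 2) k), A₀ = X i ^ 2 * A₀' ∧ constantCoeff A₀' = 0 ∧
        ∀ c : k, c ≠ 0 → ∀ (A' : MvPowerSeries (Fin 2) k) (α β : k),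
        A' = C (c ^ 2) * subst (fun l : Fin 2 => if l = i then C c * X 0 else (X 1 : MvPowerSeries (Fin 2) k)) A₀' →
        α ^ 2 = coeff (Finsupp.single 0 2) A' → β ^ 2 = coeff (Finsupp.single 1 2) A' →
        (2 : ℕ∞) < (A' + (C α * X 0 + C β * X 1) ^ 2).order →
        T (A' + (C α * X 0 + C β * X 1) ^ 2) ∨ ∃ s' : S, κ s' (A' + (C α * X 0 + C β * X 1) ^ 2) < κ s A₀)) :
    ∀ (s : S) (A₀ : MvPowerSeries (Fin 2) k), (2 : ℕ∞) < A₀.order →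
      CobordantGame.Won k 3 (X (Fin.last 2) ^ 2 + rename (Fin.succAboveEmb (Fin.last 2)) A₀) := by
  suffices key : ∀ (o : Ordinal.{0}) (s : S) (A₀ : MvPowerSeries (Fin 2) k), κ s A₀ = o → (2 : ℕ∞) < A₀.order →
      Won k 3 (X (Fin.last 2) ^ 2 + rename (Fin.succAboveEmb (Fin.last 2)) A₀) from
    fun s A₀ h => key _ s A₀ rfl h
  intro o
  induction o using WellFoundedLT.induction with
  | ind o ih =>
  intro s A₀ ho hA₀
  have hres : ∀ B : MvPowerSeries (Fin 2) k, (2 : ℕ∞) < B.order → (T B ∨ ∃ s' : S, κ s' B < κ s A₀) →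
      Won k 3 (X (Fin.last 2) ^ 2 + rename (Fin.succAboveEmb (Fin.last 2)) B) := by
    intro B hB hTB
    rcases hTB with hTB | ⟨s', hlt⟩
    · exact hT B hTB
    · exact ih _ (ho ▸ hlt) s' B rfl hB
  rcases hstep s A₀ hA₀ with hTA | ⟨φ, hφ, hordφ, hresφ⟩ | ⟨θ, hθ0, hθdet, hresθ⟩ | hpoint | ⟨i, A₀', hdiv, h0, hcurve⟩
  · exact hT A₀ hTA
  · exact (won_dp_add_sq_iff φ hφ A₀).mp (hres _ hordφ hresφ)
  · exact (won_Xpow_add_xChange_iff 2 θ hθ0 hθdet A₀).mp (hres _ (two_lt_order_subst hθ0 hA₀) hresθ)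
  · exact won_insep_of_pointStep_sel k hlow A₀ hA₀ (sel s) (hsel s) fun c hc A' α β hfac hα hβ hord =>
      hres _ hord (hpoint c hc A' α β hfac hα hβ hord)
  · exact won_insep_of_curveStep k hlow i A₀ A₀' hdiv h0 fun c hc A' α β hA' hα hβ hord =>
      hres _ hord (hcurve c hc A' α β hA' hα hβ hord)

end Summit.ResolutionOfSingularities.ResolutionOfSingularities.Theorems
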